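import Mathlib
import Summits.QuantumFields.YangMills.Theorems.TransverseWardBLSectorTransfer
import HarnessLib

/-!
# The transverse second-moment estimate on the small-field cut of Wilson `U(1)₄` (sum over flux sectors)

Route-independent helper for the crux stmt-QuantumFields-23103 `Theses.TransverseWardBL.ConvexPhaseCoexactBound`
(route `TransverseWardBL`, LINE g9-C of the ideator seat ym-idea-4; abelian `U(1)` line onto the leaf
`Theorems.U1HelicityGapTorusD4` — nothing here bears on the Yang–Mills mass gap).

* `sector_estimate` — per flux sector `k`, on the closed polytope `P_k`:
  `∫_{P_k} f̃² w̃ ≤ ((1 − cos 1)²/(β cos 1)) ‖u‖₂² ∫_{P_k} w̃` (sector Poincaré bound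
  `sectorPoincare_submodule`, null faces `sectorBox_ae_eq_open`, zero mean `sector_mean_zero`);
* `cut_estimate` — **on the whole cut** `G = {∀ p, |ω_p(U)| ≤ 1}` of the torus `U(1)^E` with product Haar
  measure: `∫ 1_G f² W ≤ ((1 − cos 1)²/(β cos 1)) ‖u‖₂² ∫ 1_G W` and `0 < ∫ 1_G W`, where
  `f(U) = Σ u_p sin ω_p(U)`, `W(U) = e^{βΣ_q cos ω_q(U)}`, for every transverse (`u ⊥ im d`) test form with
  vanishing orientation sums (sum of the sector identities of `exists_sectorChart_constant` over all flux
  sectors `k ∈ ℤ⁶`).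
-/

noncomputable section

open scoped BigOperators ENNReal
open MeasureTheory Finset Set
open Literature.MathematicalPhysics.QuantumLattice Literature.MathematicalPhysics.QuantumFieldTheory
open Summit.QuantumFields.YangMills.Theorems.SelfNormalisedSkewness.Negative

namespace Summit.QuantumFields.YangMills.Theorems.TransverseWardBL

variable {S : ℕ} [NeZero S]

/-! ### The per-sector estimate -/

/-- **Per-sector transverse estimate** (closed polytope `P_k`):
`∫_{P_k} f̃² w̃ ≤ ((1 − cos 1)²/(β cos 1)) (Σ u_p²) ∫_{P_k} w̃`. [folklore] -/
theorem sector_estimate {c : ℝ≥0∞} (hc0 : c ≠ 0) (hct : c ≠ ⊤)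
    (hc : ∀ (k : {q : Fin 4 × Fin 4 // q.1 < q.2} → ℤ)
      (g : EuclideanSpace ℝ (Plaquette 4 S) → ℝ≥0∞), Measurable g →
      ∫⁻ U, {U : GaugeConfig 4 S Circle | (∀ p : Plaquette 4 S, |plaqAngle U p| ≤ 1) ∧
          ∀ o : {q : Fin 4 × Fin 4 // q.1 < q.2}, magneticFlux U 0 o.1.1 o.1.2 = 2 * Real.pi * k o}.indicator
          (fun U => g (plaqAngle U)) U ∂(Measure.pi fun _ : Edge 4 S => haarProbability Circle) =
        c * ∫⁻ v : LinearMap.range (plaqCoboundary S),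
          {v : LinearMap.range (plaqCoboundary S) | ∀ p : Plaquette 4 S,
            |(v : EuclideanSpace ℝ (Plaquette 4 S)) p +
              2 * Real.pi * ((if p.1 p.2.1.1 = 0 ∧ p.1 p.2.1.2 = 0 then k p.2 else 0 : ℤ) : ℝ)| ≤ 1}.indicator
            (fun v => g ((v : EuclideanSpace ℝ (Plaquette 4 S)) + WithLp.toLp 2 (fun p : Plaquette 4 S =>
              2 * Real.pi * ((if p.1 p.2.1.1 = 0 ∧ p.1 p.2.1.2 = 0 then k p.2 else 0 : ℤ) : ℝ)))) v)
    (k : {q : Fin 4 × Fin 4 // q.1 < q.2} → ℤ) {β : ℝ} (hβ : 0 < β) (u : Plaquette 4 S → ℝ)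
    (hu0 : ∀ o : {q : Fin 4 × Fin 4 // q.1 < q.2}, (∑ q : Plaquette 4 S, (if q.2 = o then u q else 0)) = 0)
    (huV : ∀ w ∈ LinearMap.range (plaqCoboundary S),
      ∑ p : Plaquette 4 S, u p * (w : EuclideanSpace ℝ (Plaquette 4 S)) p = 0) :
    (∫ v in {v : LinearMap.range (plaqCoboundary S) | ∀ p : Plaquette 4 S,
        |(v : EuclideanSpace ℝ (Plaquette 4 S)) p +
          2 * Real.pi * ((if p.1 p.2.1.1 = 0 ∧ p.1 p.2.1.2 = 0 then k p.2 else 0 : ℤ) : ℝ)| ≤ 1},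
      (∑ p : Plaquette 4 S, u p * Real.sin ((v : EuclideanSpace ℝ (Plaquette 4 S)) p +
          2 * Real.pi * ((if p.1 p.2.1.1 = 0 ∧ p.1 p.2.1.2 = 0 then k p.2 else 0 : ℤ) : ℝ))) ^ 2 *
        Real.exp (β * ∑ q : Plaquette 4 S, Real.cos ((v : EuclideanSpace ℝ (Plaquette 4 S)) q +
          2 * Real.pi * ((if q.1 q.2.1.1 = 0 ∧ q.1 q.2.1.2 = 0 then k q.2 else 0 : ℤ) : ℝ)))) ≤
    (1 - Real.cos 1) ^ 2 / (β * Real.cos 1) * (∑ p, u p ^ 2) *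
      ∫ v in {v : LinearMap.range (plaqCoboundary S) | ∀ p : Plaquette 4 S,
        |(v : EuclideanSpace ℝ (Plaquette 4 S)) p +
          2 * Real.pi * ((if p.1 p.2.1.1 = 0 ∧ p.1 p.2.1.2 = 0 then k p.2 else 0 : ℤ) : ℝ)| ≤ 1},
        Real.exp (β * ∑ q : Plaquette 4 S, Real.cos ((v : EuclideanSpace ℝ (Plaquette 4 S)) q +
          2 * Real.pi * ((if q.1 q.2.1.1 = 0 ∧ q.1 q.2.1.2 = 0 then k q.2 else 0 : ℤ) : ℝ))) := by
  classical
  set nk : Plaquette 4 S → ℤ := fun p => if p.1 p.2.1.1 = 0 ∧ p.1 p.2.1.2 = 0 then k p.2 else 0 with hnk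
  set Pc : Set (LinearMap.range (plaqCoboundary S)) := {v | ∀ p : Plaquette 4 S,
    |(v : EuclideanSpace ℝ (Plaquette 4 S)) p + 2 * Real.pi * (nk p : ℝ)| ≤ 1} with hPc
  set Po : Set (LinearMap.range (plaqCoboundary S)) := {v | ∀ p : Plaquette 4 S,
    |(v : EuclideanSpace ℝ (Plaquette 4 S)) p + 2 * Real.pi * (nk p : ℝ)| < 1} with hPo
  set wt : LinearMap.range (plaqCoboundary S) → ℝ := fun v =>
    Real.exp (β * ∑ q : Plaquette 4 S, Real.cos ((v : EuclideanSpace ℝ (Plaquette 4 S)) q +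
      2 * Real.pi * (nk q : ℝ))) with hwt
  set fu : LinearMap.range (plaqCoboundary S) → ℝ := fun v =>
    ∑ p : Plaquette 4 S, u p * Real.sin ((v : EuclideanSpace ℝ (Plaquette 4 S)) p + 2 * Real.pi * (nk p : ℝ))
    with hfu
  set K : ℝ := (1 - Real.cos 1) ^ 2 / (β * Real.cos 1) with hK
  set Su : ℝ := ∑ p, u p ^ 2 with hSu
  have hcos1 : 0 < Real.cos 1 := Real.cos_pos_of_mem_Ioo ⟨by linarith [Real.pi_gt_three], by linarith [Real.pi_gt_three]⟩
  have hK0 : 0 ≤ K := by positivity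
  have hSu0 : 0 ≤ Su := Finset.sum_nonneg fun p _ => sq_nonneg _
  -- the sector Poincaré bound on the OPEN box, transported to the closed box
  have hae : Po =ᵐ[volume] Pc := sectorBox_ae_eq_open nk
  have hP := sectorPoincare_submodule (LinearMap.range (plaqCoboundary S)) u huV hβ
    (fun p => -(2 * Real.pi * (nk p : ℝ)))
  simp only [sub_neg_eq_add] at hP
  rw [setIntegral_congr_set hae, setIntegral_congr_set hae, setIntegral_congr_set hae] at hP
  -- the mean vanishes
  have hmean : ∫ v in Pc, fu v * wt v = 0 := by
    have h := sector_mean_zero (S := S) hc0 hct hc k β u hu0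
    simp only [PiLp.add_apply] at h
    simpa [hfu, hwt, hnk, hPc] using h
  change (∫ v in Pc, wt v) * (∫ v in Pc, fu v ^ 2 * wt v) - (∫ v in Pc, fu v * wt v) ^ 2 ≤
    K * Su * (∫ v in Pc, wt v) ^ 2 at hP
  rw [hmean] at hP
  simp only [zero_pow two_ne_zero, sub_zero] at hP
  change ∫ v in Pc, fu v ^ 2 * wt v ≤ K * Su * ∫ v in Pc, wt v
  -- case analysis on the sector mass
  set Z : ℝ := ∫ v in Pc, wt v with hZ
  set I₂ : ℝ := ∫ v in Pc, fu v ^ 2 * wt v with hI₂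
  have hw0 : ∀ v, 0 < wt v := fun v => Real.exp_pos _
  have hZ0 : 0 ≤ Z := setIntegral_nonneg (measurableSet_sectorBox _) fun v _ => (hw0 v).le
  rcases hZ0.eq_or_lt with hZz | hZp
  · -- `Z = 0`: then `I₂ ≤ C² Z = 0`
    set C : ℝ := ∑ p : Plaquette 4 S, |u p| with hC
    have hvol := volume_sectorBox_lt_top (S := S) (fun p => 2 * Real.pi * (nk p : ℝ))
    have hPm : MeasurableSet Pc := measurableSet_sectorBox _
    have hcoord : ∀ p : Plaquette 4 S, Continuous fun v : LinearMap.range (plaqCoboundary S) =>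
        (v : EuclideanSpace ℝ (Plaquette 4 S)) p := fun p =>
      (EuclideanSpace.proj p : EuclideanSpace ℝ (Plaquette 4 S) →L[ℝ] ℝ).continuous.comp continuous_subtype_val
    have hwc : Continuous wt := Real.continuous_exp.comp (continuous_const.mul
      (continuous_finsetSum _ fun q _ => Real.continuous_cos.comp ((hcoord q).add continuous_const)))
    have hfc : Continuous fu := continuous_finsetSum _ fun p _ =>
      continuous_const.mul (Real.continuous_sin.comp ((hcoord p).add continuous_const))
    have hBw : ∀ v, wt v ≤ Real.exp (|β| * Fintype.card (Plaquette 4 S)) := fun v =>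
      exp_mul_sum_cos_le β (WithLp.toLp 2 fun q => (v : EuclideanSpace ℝ (Plaquette 4 S)) q + 2 * Real.pi * (nk q : ℝ))
    have hfb : ∀ v, |fu v| ≤ C := fun v =>
      abs_sum_mul_sin_le u (WithLp.toLp 2 fun q => (v : EuclideanSpace ℝ (Plaquette 4 S)) q + 2 * Real.pi * (nk q : ℝ))
    have hi1 : IntegrableOn (fun v => fu v ^ 2 * wt v) Pc volume :=
      Measure.integrableOn_of_bounded (M := C ^ 2 * Real.exp (|β| * Fintype.card (Plaquette 4 S))) hvol.ne
        (((hfc.pow 2).mul hwc).measurable.aestronglyMeasurable)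
        (ae_of_all _ fun v => by
          rw [Real.norm_eq_abs, abs_mul, abs_of_nonneg (sq_nonneg _), abs_of_pos (hw0 v)]
          refine mul_le_mul ?_ (hBw v) (hw0 v).le (sq_nonneg _)
          calc fu v ^ 2 = |fu v| ^ 2 := (sq_abs _).symm
            _ ≤ C ^ 2 := pow_le_pow_left₀ (abs_nonneg _) (hfb v) 2)
    have hi2 : IntegrableOn (fun v => C ^ 2 * wt v) Pc volume :=
      Measure.integrableOn_of_bounded (M := C ^ 2 * Real.exp (|β| * Fintype.card (Plaquette 4 S))) hvol.ne
        ((continuous_const.mul hwc).measurable.aestronglyMeasurable)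
        (ae_of_all _ fun v => by
          rw [Real.norm_eq_abs, abs_mul, abs_of_nonneg (sq_nonneg _), abs_of_pos (hw0 v)]
          exact mul_le_mul_of_nonneg_left (hBw v) (sq_nonneg _))
    have hle : I₂ ≤ C ^ 2 * Z := by
      rw [hI₂, hZ, ← integral_const_mul]
      refine setIntegral_mono_on hi1 hi2 hPm fun v _ => ?_
      refine mul_le_mul_of_nonneg_right ?_ (hw0 v).le
      calc fu v ^ 2 = |fu v| ^ 2 := (sq_abs _).symm
        _ ≤ C ^ 2 := pow_le_pow_left₀ (abs_nonneg _) (hfb v) 2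
    rw [← hZz] at hle ⊢
    simp only [mul_zero] at hle ⊢
    exact hle
  · -- `Z > 0`: divide the quadratic inequality by `Z`
    have h1 : Z * I₂ ≤ Z * (K * Su * Z) := by nlinarith [hP]
    exact le_of_mul_le_mul_left h1 hZp

/-! ### Sum over the flux sectors -/

/-- The cut decomposes into the flux sectors: `1_G F = Σ_k 1_{G_k} F` pointwise. [folklore] -/
theorem indicator_cut_eq_tsum_sector (F : GaugeConfig 4 S Circle → ℝ≥0∞) (U : GaugeConfig 4 S Circle) :
    {U : GaugeConfig 4 S Circle | ∀ p : Plaquette 4 S, |plaqAngle U p| ≤ 1}.indicator F U =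
      ∑' k : ({q : Fin 4 × Fin 4 // q.1 < q.2} → ℤ),
        {U : GaugeConfig 4 S Circle | (∀ p : Plaquette 4 S, |plaqAngle U p| ≤ 1) ∧
          ∀ o : {q : Fin 4 × Fin 4 // q.1 < q.2}, magneticFlux U 0 o.1.1 o.1.2 = 2 * Real.pi * k o}.indicator F U := by
  classical
  obtain ⟨k₀, hk₀⟩ := exists_fluxIndex U
  by_cases hU : ∀ p : Plaquette 4 S, |plaqAngle U p| ≤ 1
  · rw [Set.indicator_of_mem (show U ∈ {U : GaugeConfig 4 S Circle | ∀ p, |plaqAngle U p| ≤ 1} from hU)]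
    rw [tsum_eq_single k₀]
    · rw [Set.indicator_of_mem]
      exact ⟨hU, hk₀⟩
    · intro k hk
      rw [Set.indicator_of_notMem]
      rintro ⟨-, hk'⟩
      apply hk
      funext o
      have h := (hk' o).symm.trans (hk₀ o)
      have hπ : (2 * Real.pi : ℝ) ≠ 0 := by positivity
      exact_mod_cast mul_left_cancel₀ hπ h
  · rw [Set.indicator_of_notMem (show U ∉ {U : GaugeConfig 4 S Circle | ∀ p, |plaqAngle U p| ≤ 1} from hU)]
    symm
    refine ENNReal.tsum_eq_zero.2 fun k => Set.indicator_of_notMem ?_ _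
    rintro ⟨h1, -⟩
    exact hU h1

/-- `|z_p| ≤ ‖z‖` on `ℝ^P`. [folklore] -/
theorem abs_apply_le_norm (z : EuclideanSpace ℝ (Plaquette 4 S)) (p : Plaquette 4 S) : |z p| ≤ ‖z‖ := by
  rw [← sqrt_sum_sq_eq_norm, ← Real.sqrt_sq (abs_nonneg (z p)), sq_abs]
  exact Real.sqrt_le_sqrt (Finset.single_le_sum (fun q _ => sq_nonneg (z q)) (Finset.mem_univ p))

/-- **The transverse estimate on the whole cut** (sum of the sector estimates over all flux sectors, via
the sector chart identities), together with positivity of the cut mass. [folklore] -/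
theorem cut_estimate {β : ℝ} (hβ : 0 < β) (u : Plaquette 4 S → ℝ)
    (hu0 : ∀ o : {q : Fin 4 × Fin 4 // q.1 < q.2}, (∑ q : Plaquette 4 S, (if q.2 = o then u q else 0)) = 0)
    (huV : ∀ w ∈ LinearMap.range (plaqCoboundary S),
      ∑ p : Plaquette 4 S, u p * (w : EuclideanSpace ℝ (Plaquette 4 S)) p = 0) :
    (∫ U, {U : GaugeConfig 4 S Circle | ∀ p : Plaquette 4 S, |plaqAngle U p| ≤ 1}.indicator
        (fun U => (∑ p : Plaquette 4 S, u p * Real.sin (plaqAngle U p)) ^ 2 *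
          Real.exp (β * ∑ q : Plaquette 4 S, Real.cos (plaqAngle U q))) U
        ∂(Measure.pi fun _ : Edge 4 S => haarProbability Circle)) ≤
      (1 - Real.cos 1) ^ 2 / (β * Real.cos 1) * (∑ p, u p ^ 2) *
        ∫ U, {U : GaugeConfig 4 S Circle | ∀ p : Plaquette 4 S, |plaqAngle U p| ≤ 1}.indicator
          (fun U => Real.exp (β * ∑ q : Plaquette 4 S, Real.cos (plaqAngle U q))) U
          ∂(Measure.pi fun _ : Edge 4 S => haarProbability Circle) ∧
    0 < ∫ U, {U : GaugeConfig 4 S Circle | ∀ p : Plaquette 4 S, |plaqAngle U p| ≤ 1}.indicator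
          (fun U => Real.exp (β * ∑ q : Plaquette 4 S, Real.cos (plaqAngle U q))) U
          ∂(Measure.pi fun _ : Edge 4 S => haarProbability Circle) := by
  classical
  obtain ⟨c, hc0, hct, hc⟩ := exists_sectorChart_constant S
  set μH : Measure (GaugeConfig 4 S Circle) := Measure.pi fun _ : Edge 4 S => haarProbability Circle with hμH
  set G : Set (GaugeConfig 4 S Circle) := {U | ∀ p : Plaquette 4 S, |plaqAngle U p| ≤ 1} with hG
  set K : ℝ := (1 - Real.cos 1) ^ 2 / (β * Real.cos 1) with hK
  set Su : ℝ := ∑ p, u p ^ 2 with hSu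
  have hcos1 : 0 < Real.cos 1 := Real.cos_pos_of_mem_Ioo ⟨by linarith [Real.pi_gt_three], by linarith [Real.pi_gt_three]⟩
  have hKS : 0 ≤ K * Su := mul_nonneg (by positivity) (Finset.sum_nonneg fun p _ => sq_nonneg _)
  -- the two integrands on `ℝ^P`
  set g₂ : EuclideanSpace ℝ (Plaquette 4 S) → ℝ := fun z =>
    (∑ p : Plaquette 4 S, u p * Real.sin (z p)) ^ 2 * Real.exp (β * ∑ q : Plaquette 4 S, Real.cos (z q)) with hg₂
  set g₀ : EuclideanSpace ℝ (Plaquette 4 S) → ℝ := fun z =>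
    Real.exp (β * ∑ q : Plaquette 4 S, Real.cos (z q)) with hg₀
  set C : ℝ := ∑ p : Plaquette 4 S, |u p| with hC
  set Bw : ℝ := Real.exp (|β| * Fintype.card (Plaquette 4 S)) with hBw
  have hcoord : ∀ p : Plaquette 4 S, Continuous fun z : EuclideanSpace ℝ (Plaquette 4 S) => z p := fun p =>
    (EuclideanSpace.proj p : EuclideanSpace ℝ (Plaquette 4 S) →L[ℝ] ℝ).continuous
  have hg₀c : Continuous g₀ := Real.continuous_exp.comp (continuous_const.mul
    (continuous_finsetSum _ fun q _ => Real.continuous_cos.comp (hcoord q)))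
  have hg₂c : Continuous g₂ := ((continuous_finsetSum _ fun p _ =>
    continuous_const.mul (Real.continuous_sin.comp (hcoord p))).pow 2).mul hg₀c
  have hg₀0 : ∀ z, 0 < g₀ z := fun z => Real.exp_pos _
  have hg₀b : ∀ z, g₀ z ≤ Bw := fun z => exp_mul_sum_cos_le β z
  have hg₂0 : ∀ z, 0 ≤ g₂ z := fun z => mul_nonneg (sq_nonneg _) (hg₀0 z).le
  have hg₂b : ∀ z, g₂ z ≤ C ^ 2 * Bw := fun z => by
    refine mul_le_mul ?_ (hg₀b z) (hg₀0 z).le (sq_nonneg _)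
    calc (∑ p : Plaquette 4 S, u p * Real.sin (z p)) ^ 2 = |∑ p : Plaquette 4 S, u p * Real.sin (z p)| ^ 2 :=
          (sq_abs _).symm
      _ ≤ C ^ 2 := pow_le_pow_left₀ (abs_nonneg _) (abs_sum_mul_sin_le u z) 2
  -- real sector integrals
  have hreal : ∀ (g : EuclideanSpace ℝ (Plaquette 4 S) → ℝ), Continuous g → ∀ B : ℝ, (∀ z, 0 ≤ g z) → (∀ z, g z ≤ B) →
      ∀ k : ({q : Fin 4 × Fin 4 // q.1 < q.2} → ℤ),
      ∫⁻ U, {U : GaugeConfig 4 S Circle | (∀ p : Plaquette 4 S, |plaqAngle U p| ≤ 1) ∧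
          ∀ o : {q : Fin 4 × Fin 4 // q.1 < q.2}, magneticFlux U 0 o.1.1 o.1.2 = 2 * Real.pi * k o}.indicator
          (fun U => ENNReal.ofReal (g (plaqAngle U))) U ∂μH =
        c * ENNReal.ofReal (∫ v in {v : LinearMap.range (plaqCoboundary S) | ∀ p : Plaquette 4 S,
            |(v : EuclideanSpace ℝ (Plaquette 4 S)) p +
              2 * Real.pi * ((if p.1 p.2.1.1 = 0 ∧ p.1 p.2.1.2 = 0 then k p.2 else 0 : ℤ) : ℝ)| ≤ 1},
          g ((v : EuclideanSpace ℝ (Plaquette 4 S)) + WithLp.toLp 2 (fun p : Plaquette 4 S =>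
            2 * Real.pi * ((if p.1 p.2.1.1 = 0 ∧ p.1 p.2.1.2 = 0 then k p.2 else 0 : ℤ) : ℝ)))) := by
    intro g hg B hg0 hgB k
    rw [hc k (fun z => ENNReal.ofReal (g z)) (ENNReal.measurable_ofReal.comp hg.measurable)]
    congr 1
    rw [lintegral_indicator (measurableSet_sectorBox _), ofReal_integral_eq_lintegral_ofReal]
    · exact Measure.integrableOn_of_bounded (M := B) (volume_sectorBox_lt_top _).ne
        ((hg.comp (continuous_subtype_val.add continuous_const)).measurable.aestronglyMeasurable)
        (ae_of_all _ fun v => by rw [Real.norm_eq_abs, abs_of_nonneg (hg0 _)]; exact hgB _)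
    · exact ae_of_all _ fun v => hg0 _
  -- per-sector inequality in `ℝ≥0∞`
  have hsec : ∀ k : ({q : Fin 4 × Fin 4 // q.1 < q.2} → ℤ),
      ∫⁻ U, {U : GaugeConfig 4 S Circle | (∀ p : Plaquette 4 S, |plaqAngle U p| ≤ 1) ∧
          ∀ o : {q : Fin 4 × Fin 4 // q.1 < q.2}, magneticFlux U 0 o.1.1 o.1.2 = 2 * Real.pi * k o}.indicator
          (fun U => ENNReal.ofReal (g₂ (plaqAngle U))) U ∂μH ≤
        ENNReal.ofReal (K * Su) *
          ∫⁻ U, {U : GaugeConfig 4 S Circle | (∀ p : Plaquette 4 S, |plaqAngle U p| ≤ 1) ∧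
            ∀ o : {q : Fin 4 × Fin 4 // q.1 < q.2}, magneticFlux U 0 o.1.1 o.1.2 = 2 * Real.pi * k o}.indicator
            (fun U => ENNReal.ofReal (g₀ (plaqAngle U))) U ∂μH := by
    intro k
    rw [hreal g₂ hg₂c _ hg₂0 hg₂b k, hreal g₀ hg₀c _ (fun z => (hg₀0 z).le) hg₀b k]
    have hest := sector_estimate (S := S) hc0 hct hc k hβ u hu0 huV
    have e : ∀ v : LinearMap.range (plaqCoboundary S),
        ((v : EuclideanSpace ℝ (Plaquette 4 S)) + WithLp.toLp 2 (fun p : Plaquette 4 S =>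
          2 * Real.pi * ((if p.1 p.2.1.1 = 0 ∧ p.1 p.2.1.2 = 0 then k p.2 else 0 : ℤ) : ℝ))) =
        WithLp.toLp 2 (fun p => (v : EuclideanSpace ℝ (Plaquette 4 S)) p +
          2 * Real.pi * ((if p.1 p.2.1.1 = 0 ∧ p.1 p.2.1.2 = 0 then k p.2 else 0 : ℤ) : ℝ)) := by
      intro v; ext p; simp
    simp only [e, hg₂, hg₀] at hest ⊢
    rw [mul_comm (ENNReal.ofReal (K * Su)), mul_assoc]
    refine mul_le_mul' le_rfl ?_
    rw [← ENNReal.ofReal_mul' hKS]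
    exact ENNReal.ofReal_le_ofReal (by linarith [hest])
  -- measurability upstairs
  have hφm : ∀ (g : EuclideanSpace ℝ (Plaquette 4 S) → ℝ), Continuous g →
      Measurable fun U : GaugeConfig 4 S Circle => ENNReal.ofReal (g (plaqAngle U)) := fun g hg =>
    ENNReal.measurable_ofReal.comp (hg.measurable.comp measurable_plaqAngle)
  -- sum over sectors
  have hsum : ∀ (g : EuclideanSpace ℝ (Plaquette 4 S) → ℝ), Continuous g →
      ∫⁻ U, G.indicator (fun U => ENNReal.ofReal (g (plaqAngle U))) U ∂μH =
        ∑' k : ({q : Fin 4 × Fin 4 // q.1 < q.2} → ℤ),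
          ∫⁻ U, {U : GaugeConfig 4 S Circle | (∀ p : Plaquette 4 S, |plaqAngle U p| ≤ 1) ∧
            ∀ o : {q : Fin 4 × Fin 4 // q.1 < q.2}, magneticFlux U 0 o.1.1 o.1.2 = 2 * Real.pi * k o}.indicator
            (fun U => ENNReal.ofReal (g (plaqAngle U))) U ∂μH := by
    intro g hg
    rw [← lintegral_tsum fun k => ((hφm g hg).indicator (measurableSet_sector k)).aemeasurable]
    exact lintegral_congr fun U => indicator_cut_eq_tsum_sector _ U
  have hL : ∫⁻ U, G.indicator (fun U => ENNReal.ofReal (g₂ (plaqAngle U))) U ∂μH ≤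
      ENNReal.ofReal (K * Su) * ∫⁻ U, G.indicator (fun U => ENNReal.ofReal (g₀ (plaqAngle U))) U ∂μH := by
    rw [hsum g₂ hg₂c, hsum g₀ hg₀c, ← ENNReal.tsum_mul_left]
    exact ENNReal.tsum_le_tsum hsec
  -- back to real integrals
  have hintU : ∀ (g : EuclideanSpace ℝ (Plaquette 4 S) → ℝ), Continuous g → ∀ B : ℝ, (∀ z, 0 ≤ g z) → (∀ z, g z ≤ B) →
      Integrable (G.indicator fun U : GaugeConfig 4 S Circle => g (plaqAngle U)) μH ∧
      ∫⁻ U, G.indicator (fun U => ENNReal.ofReal (g (plaqAngle U))) U ∂μH =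
        ENNReal.ofReal (∫ U, G.indicator (fun U => g (plaqAngle U)) U ∂μH) := by
    intro g hg B hg0 hgB
    have hGm : MeasurableSet G := by
      have e : G = ⋂ p : Plaquette 4 S, {U | |plaqAngle U p| ≤ 1} := by ext U; simp [hG]
      rw [e]
      exact MeasurableSet.iInter fun p => measurableSet_le (measurable_plaqAngle_apply p).abs measurable_const
    have hi : Integrable (G.indicator fun U : GaugeConfig 4 S Circle => g (plaqAngle U)) μH := by
      refine Integrable.of_bound (((hg.measurable.comp measurable_plaqAngle).indicator hGm).aestronglyMeasurable) B
        (ae_of_all _ fun U => ?_)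
      rw [Real.norm_eq_abs]
      by_cases hU : U ∈ G
      · rw [Set.indicator_of_mem hU, abs_of_nonneg (hg0 _)]; exact hgB _
      · rw [Set.indicator_of_notMem hU, abs_zero]; exact (hg0 0).trans (hgB 0)
    refine ⟨hi, ?_⟩
    rw [ofReal_integral_eq_lintegral_ofReal hi (ae_of_all _ fun U => Set.indicator_nonneg (fun _ _ => hg0 _) U)]
    refine lintegral_congr fun U => ?_
    by_cases hU : U ∈ G
    · rw [Set.indicator_of_mem hU, Set.indicator_of_mem hU]
    · rw [Set.indicator_of_notMem hU, Set.indicator_of_notMem hU, ENNReal.ofReal_zero]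
  obtain ⟨hi₂, hL₂⟩ := hintU g₂ hg₂c _ hg₂0 hg₂b
  obtain ⟨hi₀, hL₀⟩ := hintU g₀ hg₀c _ (fun z => (hg₀0 z).le) hg₀b
  have hA₀ : 0 ≤ ∫ U, G.indicator (fun U => g₀ (plaqAngle U)) U ∂μH :=
    integral_nonneg fun U => Set.indicator_nonneg (fun _ _ => (hg₀0 _).le) U
  constructor
  · have h := hL
    rw [hL₂, hL₀, ← ENNReal.ofReal_mul' hA₀] at h
    have := (ENNReal.ofReal_le_ofReal_iff (mul_nonneg hKS hA₀)).1 h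
    simpa [hg₂, hg₀, hK, hSu] using this
  · -- positivity: the zero-flux sector has positive mass
    have h0 := hreal g₀ hg₀c _ (fun z => (hg₀0 z).le) hg₀b (fun _ => 0)
    have hle : ∫⁻ U, {U : GaugeConfig 4 S Circle | (∀ p : Plaquette 4 S, |plaqAngle U p| ≤ 1) ∧
        ∀ o : {q : Fin 4 × Fin 4 // q.1 < q.2}, magneticFlux U 0 o.1.1 o.1.2 = 2 * Real.pi * (0 : ℤ)}.indicator
        (fun U => ENNReal.ofReal (g₀ (plaqAngle U))) U ∂μH ≤
        ∫⁻ U, G.indicator (fun U => ENNReal.ofReal (g₀ (plaqAngle U))) U ∂μH := by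
      rw [hsum g₀ hg₀c]
      exact ENNReal.le_tsum (fun _ => (0 : ℤ))
    -- the zero-sector polytope contains the unit ball of `V`
    set P0 : Set (LinearMap.range (plaqCoboundary S)) := {v | ∀ p : Plaquette 4 S,
      |(v : EuclideanSpace ℝ (Plaquette 4 S)) p + 2 * Real.pi * ((if p.1 p.2.1.1 = 0 ∧ p.1 p.2.1.2 = 0 then
        (fun _ : {q : Fin 4 × Fin 4 // q.1 < q.2} => (0 : ℤ)) p.2 else 0 : ℤ) : ℝ)| ≤ 1} with hP0
    have hball : Metric.ball (0 : LinearMap.range (plaqCoboundary S)) 1 ⊆ P0 := by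
      intro v hv p
      simp only [ite_self, Int.cast_zero, mul_zero, add_zero]
      rw [Metric.mem_ball, dist_zero_right] at hv
      have := abs_apply_le_norm (v : EuclideanSpace ℝ (Plaquette 4 S)) p
      have hn : ‖(v : EuclideanSpace ℝ (Plaquette 4 S))‖ = ‖v‖ := Submodule.coe_norm v
      rw [hn] at this
      linarith
    have hP0m : MeasurableSet P0 := measurableSet_sectorBox _
    have hvol0 : 0 < volume P0 :=
      (Metric.measure_ball_pos volume (0 : LinearMap.range (plaqCoboundary S)) one_pos).trans_le (measure_mono hball)
    have hvolT : volume P0 < ⊤ := volume_sectorBox_lt_top _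
    set cv0 : EuclideanSpace ℝ (Plaquette 4 S) := WithLp.toLp 2 (fun p : Plaquette 4 S =>
        2 * Real.pi * ((if p.1 p.2.1.1 = 0 ∧ p.1 p.2.1.2 = 0 then
          (fun _ : {q : Fin 4 × Fin 4 // q.1 < q.2} => (0 : ℤ)) p.2 else 0 : ℤ) : ℝ)) with hcv0
    have hint0 : IntegrableOn (fun v : LinearMap.range (plaqCoboundary S) =>
        g₀ ((v : EuclideanSpace ℝ (Plaquette 4 S)) + cv0)) P0 volume := by
      refine Measure.integrableOn_of_bounded (M := Bw) hvolT.ne ?_ (ae_of_all _ fun v => ?_)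
      · exact ((hg₀c.comp (continuous_subtype_val.add continuous_const)).measurable).aestronglyMeasurable
      · rw [Real.norm_eq_abs, abs_of_pos (hg₀0 _)]; exact hg₀b _
    have hlowpt : ∀ v ∈ P0, Real.exp (-(|β| * Fintype.card (Plaquette 4 S))) ≤
        g₀ ((v : EuclideanSpace ℝ (Plaquette 4 S)) + cv0) := by
      intro v _
      have hb : |β * ∑ q : Plaquette 4 S, Real.cos (((v : EuclideanSpace ℝ (Plaquette 4 S)) + cv0) q)| ≤
          |β| * Fintype.card (Plaquette 4 S) := by
        rw [abs_mul]
        refine mul_le_mul_of_nonneg_left ?_ (abs_nonneg β)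
        refine (Finset.abs_sum_le_sum_abs _ _).trans ?_
        calc ∑ q : Plaquette 4 S, |Real.cos (((v : EuclideanSpace ℝ (Plaquette 4 S)) + cv0) q)|
            ≤ ∑ _q : Plaquette 4 S, (1 : ℝ) := Finset.sum_le_sum fun q _ => Real.abs_cos_le_one _
          _ = Fintype.card (Plaquette 4 S) := by simp
      exact Real.exp_le_exp.2 (abs_le.1 hb).1
    have hlow := setIntegral_ge_of_const_le_real (μ := volume) hP0m hvolT.ne hlowpt hint0
    have hZ0 : 0 < ∫ v in P0, g₀ ((v : EuclideanSpace ℝ (Plaquette 4 S)) + cv0) := by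
      refine lt_of_lt_of_le (mul_pos (Real.exp_pos _) ?_) hlow
      exact ENNReal.toReal_pos hvol0.ne' hvolT.ne
    have hpos : 0 < ∫⁻ U, G.indicator (fun U => ENNReal.ofReal (g₀ (plaqAngle U))) U ∂μH := by
      refine lt_of_lt_of_le ?_ hle
      rw [h0]
      exact ENNReal.mul_pos hc0 (ENNReal.ofReal_pos.2 hZ0).ne'
    rw [hL₀] at hpos
    have := ENNReal.ofReal_pos.1 hpos
    simpa [hg₀] using this

end Summit.QuantumFields.YangMills.Theorems.TransverseWardBL

end
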